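import Mathlib
import HarnessLib
import Literature.MathematicalPhysics.QuantumLattice.HubbardSpaceTimeCharacters
import Summits.HubbardSuperconductivity.HubbardSuperconductivity.Theorems.KLProgrammeKLRegimeSliceSymbolTorus

/-!
# Route `KLProgramme` — engine support (route (L2)): the row and column sums of the sectorised counterterm slice covariance
# `Sᵀ(F)·C^K_{(Λ,Λ′]}·S(F)` reduce to the `ℓ¹` norms of ONE product-torus character sum per sector pair — the left-hand side of the
# master lemma `sum_norm_charSum_le_of_second_differences` — and a discrete Leibniz rule for the product symbol

Cell `gate-hubbard-kl`, seat hubbard-kl-k3c2-p3 (row «sector-counting import (DR2000 L11/L12) for the leg-dress bar»), for the ENGINE child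
stmt-HubbardSuperconductivity-19823: the propagator constant `α_n` of `SectorisedEffectiveActionBound.hubbardSectorKernelNorm_effAction_le_of_sectorNorm`
is a bound on `Σ_{Y'} ‖(Sᵀ C S) Y Y'‖` (rows) and `Σ_Y ‖(Sᵀ C S) Y Y'‖` (columns), `S = sectorSubMatrix L M β F`, for the zero-seed slice
covariance `C = hubbardCovSliceCT L M β μ 0 K Λ Λ′` of an admissible frame.  Here, with NO analysis:

* §1 `fwdDiff_mul_apply`, **`fwdDiff_iter_two_mul_apply`** (discrete Leibniz: `Δ²(fg)(x) = f(x+2w)Δ²g(x) + 2Δf(x+w)Δg(x) + Δ²f(x)g(x)`) and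
  **`norm_fwdDiff_iter_two_mul_le`** — how the pointwise second differences of the product symbol `F_ω F_{ω′} · Ψ̂` follow from those
  of the multiplier product (p4 lineage, (b₂)/(b₃)) and of the propagator profile (`KLProgrammeKLRegimeSliceSymbolTorus`);
* §2 **`sliceCharSum`** is NOT a definition but the explicit symbol `G_{ωω′}(q) = (βL²)⁻²·F_ω(k_q)·F_{ω′}(k_q)·Ψ̂_{ω(q₁)}(e_K(q₂))` written out;
  **`rowSum_norm_pullback_sliceCT_le`** / **`colSum_norm_pullback_sliceCT_le`**: for every auxiliary label `Y = (x, ((ω,σ),c))`,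
  `Σ_{Y'} ‖(Sᵀ C S) Y Y'‖ ≤ 8 · Σ_{ω′} T(ω, ω′)` and `Σ_{Y} ‖(Sᵀ C S) Y Y'‖ ≤ 8 · Σ_{ω} T(ω, ω′)` with
  `T(ω,ω′) = Σ_z ‖Σ_q χ_{q₁}(z₁)χ_{q₂}(z₂) • G_{ωω′}(q)‖` (`HubbardSpaceTimeCharacters.norm_pullback_normalCovariance_le` +
  `sum_spaceTime_eq_sum_prodTorus`, both orientations; the symbol is spin-independent).

Everything is proved; no definitions, no named facts. [folklore]

References: G. Benfatto, A. Giuliani, V. Mastropietro, Ann. Henri Poincaré 7 (2006) 809–898, §2.7 (2.66)–(2.67), §2.8 (2.81) and footnote ¹.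
-/

noncomputable section

namespace Summit.HubbardSuperconductivity.HubbardSuperconductivity.Theorems.TorusFourierL2

set_option linter.dupNamespace false -- summit = problem name (single-conjunct summit), D-0017

open Finset Complex Literature.MathematicalPhysics.QuantumLattice Literature.Probability.LatticeModels
open scoped Real

/-! ### §1 Discrete Leibniz for first and second differences -/

section Leibniz

variable {A : Type*} [AddCommMonoid A] {R : Type*} [CommRing R]

/-- `Δ(fg)(x) = f(x+w)·Δg(x) + Δf(x)·g(x)`. [folklore] -/
theorem fwdDiff_mul_apply (w : A) (f g : A → R) (x : A) :
    fwdDiff w (fun y => f y * g y) x = f (x + w) * fwdDiff w g x + fwdDiff w f x * g x := by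
  simp only [fwdDiff]; ring

/-- **Discrete Leibniz at order two**: `Δ²(fg)(x) = f(x+2w)·Δ²g(x) + 2·Δf(x+w)·Δg(x) + Δ²f(x)·g(x)` (`w+w` written `x + w + w`).
[folklore] -/
theorem fwdDiff_iter_two_mul_apply (w : A) (f g : A → R) (x : A) :
    (fwdDiff w)^[2] (fun y => f y * g y) x =
      f (x + w + w) * (fwdDiff w)^[2] g x + 2 * (fwdDiff w f (x + w) * fwdDiff w g x) + (fwdDiff w)^[2] f x * g x := by
  simp only [Function.iterate_succ_apply', Function.iterate_zero_apply, fwdDiff]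
  ring

/-- **Norm form of the discrete Leibniz rule** (for `ℂ`-valued symbols): if `‖f‖ ≤ a₀`, `‖Δ_w f‖ ≤ a₁`, `‖Δ_w² f‖ ≤ a₂` and
`‖g‖ ≤ b₀`, `‖Δ_w g‖ ≤ b₁`, `‖Δ_w² g‖ ≤ b₂` everywhere, then `‖Δ_w²(fg)‖ ≤ a₀b₂ + 2a₁b₁ + a₂b₀`. [folklore] -/
theorem norm_fwdDiff_iter_two_mul_le (w : A) (f g : A → ℂ) {a₀ a₁ a₂ b₀ b₁ b₂ : ℝ}
    (hf0 : ∀ x, ‖f x‖ ≤ a₀) (hf1 : ∀ x, ‖fwdDiff w f x‖ ≤ a₁) (hf2 : ∀ x, ‖(fwdDiff w)^[2] f x‖ ≤ a₂)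
    (hg0 : ∀ x, ‖g x‖ ≤ b₀) (hg1 : ∀ x, ‖fwdDiff w g x‖ ≤ b₁) (hg2 : ∀ x, ‖(fwdDiff w)^[2] g x‖ ≤ b₂) (x : A) :
    ‖(fwdDiff w)^[2] (fun y => f y * g y) x‖ ≤ a₀ * b₂ + 2 * (a₁ * b₁) + a₂ * b₀ := by
  have ha0 : 0 ≤ a₀ := (norm_nonneg _).trans (hf0 x)
  have ha1 : 0 ≤ a₁ := (norm_nonneg _).trans (hf1 x)
  have hb0 : 0 ≤ b₀ := (norm_nonneg _).trans (hg0 x)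
  have hb2 : 0 ≤ b₂ := (norm_nonneg _).trans (hg2 x)
  rw [fwdDiff_iter_two_mul_apply]
  refine (norm_add_le _ _).trans (add_le_add ((norm_add_le _ _).trans (add_le_add ?_ ?_)) ?_)
  · rw [norm_mul]; exact mul_le_mul (hf0 _) (hg2 _) (norm_nonneg _) ha0
  · rw [norm_mul, norm_mul, Complex.norm_two]
    exact mul_le_mul_of_nonneg_left (mul_le_mul (hf1 _) (hg1 _) (norm_nonneg _) ha1) zero_le_two
  · rw [norm_mul]; exact mul_le_mul (hf2 _) (hg0 _) (norm_nonneg _) ((norm_nonneg _).trans (hf2 x))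

/-- **Norm form at order one**: `‖Δ_w(fg)‖ ≤ a₀b₁ + a₁b₀`. [folklore] -/
theorem norm_fwdDiff_mul_le (w : A) (f g : A → ℂ) {a₀ a₁ b₀ b₁ : ℝ}
    (hf0 : ∀ x, ‖f x‖ ≤ a₀) (hf1 : ∀ x, ‖fwdDiff w f x‖ ≤ a₁) (hg0 : ∀ x, ‖g x‖ ≤ b₀) (hg1 : ∀ x, ‖fwdDiff w g x‖ ≤ b₁) (x : A) :
    ‖fwdDiff w (fun y => f y * g y) x‖ ≤ a₀ * b₁ + a₁ * b₀ := by
  have ha0 : 0 ≤ a₀ := (norm_nonneg _).trans (hf0 x)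
  have hb0 : 0 ≤ b₀ := (norm_nonneg _).trans (hg0 x)
  rw [fwdDiff_mul_apply]
  refine (norm_add_le _ _).trans (add_le_add ?_ ?_)
  · rw [norm_mul]; exact mul_le_mul (hf0 _) (hg1 _) (norm_nonneg _) ha0
  · rw [norm_mul]; exact mul_le_mul (hf1 _) (hg0 _) (norm_nonneg _) ((norm_nonneg _).trans (hf1 x))

end Leibniz

/-! ### §2 Row and column sums of the sectorised slice covariance in terms of one character sum per sector pair -/

section Rows

variable {L M N : ℕ} [NeZero L] [NeZero M]

/-- Summing a function of `(y₀ − x₀ mod 2M, y⃗ − x⃗)` over `y` is summing over the product torus (the reversed orientation of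
`HubbardSpaceTimeCharacters.sum_spaceTime_eq_sum_prodTorus`). [folklore] -/
theorem sum_spaceTime_eq_sum_prodTorus_rev {E : Type*} [AddCommMonoid E]
    (h : TorusSite 1 (2 * M) × TorusSite 2 L → E) (x : SpaceTimeIdx L M) :
    ∑ y : SpaceTimeIdx L M, h ((fun _ : Fin 1 => ((y.1 : ℕ) : ZMod (2 * M)) - ((x.1 : ℕ) : ZMod (2 * M))), y.2 - x.2) =
      ∑ q : TorusSite 1 (2 * M) × TorusSite 2 L, h q := by
  have h1 := sum_spaceTime_eq_sum_prodTorus (fun q : TorusSite 1 (2 * M) × TorusSite 2 L => h (-q.1, -q.2)) x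
  have h2 : ∑ q : TorusSite 1 (2 * M) × TorusSite 2 L, h (-q.1, -q.2) = ∑ q : TorusSite 1 (2 * M) × TorusSite 2 L, h q := by
    exact Fintype.sum_equiv ((Equiv.neg (TorusSite 1 (2 * M))).prodCongr (Equiv.neg (TorusSite 2 L))) _ _ fun q => rfl
  rw [← h2, ← h1]
  refine Finset.sum_congr rfl fun y _ => ?_
  congr 1
  ext
  · simp
  · simp

/-- **Row sums of the sectorised zero-seed CT slice covariance** reduce to one character-sum `ℓ¹` norm per sector pair: for every
auxiliary label `Y = (x, ((ω,σ),c))`,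
`Σ_{Y'} ‖(Sᵀ C^K_{(Λ,Λ′]} S) Y Y'‖ ≤ 8 · Σ_{ω′} Σ_z ‖Σ_q χ_{q₁}(z₁)χ_{q₂}(z₂) • G_{ωω′}(q)‖`,
`G_{ωω′}(q) = (βL²)⁻² F_ω(k_q) F_{ω′}(k_q) Ψ̂_{ω(q₁)}(e_K(q₂))` (the factor `8 = 2 spins × 2 charges × 2 orientations`).
[cite: BenfattoGiulianiMastropietro2006, §2.7 (2.66)–(2.67)] -/
theorem rowSum_norm_pullback_sliceCT_le {β : ℝ} (hβ : β ≠ 0) (μ : ℝ) (K : TrigPolyC4v) (Λ Λ' : ℝ)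
    (F : Fin N → FreqMomentum L M → ℂ) (Y : SpaceTimeIdx L M × SectorLeg N) :
    ∑ Y' : SpaceTimeIdx L M × SectorLeg N,
        ‖((sectorSubMatrix L M β F).transpose * hubbardCovSliceCT L M β μ 0 K Λ Λ' * sectorSubMatrix L M β F) Y Y'‖ ≤
      8 * ∑ ω' : Fin N, ∑ z : TorusSite 1 (2 * M) × TorusSite 2 L,
        ‖∑ q : TorusSite 1 (2 * M) × TorusSite 2 L, (torusChar q.1 z.1 * torusChar q.2 z.2) •
          ((((1 / (β * (L : ℝ) ^ 2) : ℝ) : ℂ) ^ 2 *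
            (F Y.2.1.1 (⟨(q.1 0).val, ZMod.val_lt (q.1 0)⟩, q.2) * F ω' (⟨(q.1 0).val, ZMod.val_lt (q.1 0)⟩, q.2) *
              sliceSymbolFnXi (β * (L : ℝ) ^ 2) 0 Λ Λ' (matsubaraFreq β M ⟨(q.1 0).val, ZMod.val_lt (q.1 0)⟩)
                (nambuXiCT L μ K q.2))))‖ := by
  classical
  rw [hubbardCovSliceCT_eq_normalCovariance_sliceSymbolFnXi hβ μ K Λ Λ']
  set p : FreqMomentum L M × Fin 2 → ℂ := fun ks =>
    sliceSymbolFnXi (β * (L : ℝ) ^ 2) 0 Λ Λ' (matsubaraFreq β M ks.1.1) (nambuXiCT L μ K ks.1.2) with hp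
  -- the per-pair character sum as a function on the product torus
  set T : Fin N → TorusSite 1 (2 * M) × TorusSite 2 L → ℝ := fun ω' z =>
    ‖∑ q : TorusSite 1 (2 * M) × TorusSite 2 L, (torusChar q.1 z.1 * torusChar q.2 z.2) •
      ((((1 / (β * (L : ℝ) ^ 2) : ℝ) : ℂ) ^ 2 *
        (F Y.2.1.1 (⟨(q.1 0).val, ZMod.val_lt (q.1 0)⟩, q.2) * F ω' (⟨(q.1 0).val, ZMod.val_lt (q.1 0)⟩, q.2) *
          p ((⟨(q.1 0).val, ZMod.val_lt (q.1 0)⟩, q.2), Y.2.1.2))))‖ with hT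
  -- split the sum over `Y' = (y, ℓ')`
  rw [Fintype.sum_prod_type_right]
  -- for each label `ℓ'`, the `y`-sum is at most `2 T(ω, ℓ'.ω)`
  have hℓ : ∀ ℓ' : SectorLeg N, ∑ y : SpaceTimeIdx L M,
      ‖((sectorSubMatrix L M β F).transpose * normalCovariance L M p * sectorSubMatrix L M β F) Y (y, ℓ')‖ ≤
        2 * ∑ z : TorusSite 1 (2 * M) × TorusSite 2 L, T ℓ'.1.1 z := by
    intro ℓ'
    calc ∑ y : SpaceTimeIdx L M, ‖((sectorSubMatrix L M β F).transpose * normalCovariance L M p * sectorSubMatrix L M β F) Y (y, ℓ')‖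
        ≤ ∑ y : SpaceTimeIdx L M,
            (T ℓ'.1.1 ((fun _ : Fin 1 => ((Y.1.1 : ℕ) : ZMod (2 * M)) - ((y.1 : ℕ) : ZMod (2 * M))), Y.1.2 - y.2) +
              T ℓ'.1.1 ((fun _ : Fin 1 => ((y.1 : ℕ) : ZMod (2 * M)) - ((Y.1.1 : ℕ) : ZMod (2 * M))), y.2 - Y.1.2)) :=
          Finset.sum_le_sum fun y _ => norm_pullback_normalCovariance_le hβ F p Y (y, ℓ')
      _ = ∑ z : TorusSite 1 (2 * M) × TorusSite 2 L, T ℓ'.1.1 z + ∑ z : TorusSite 1 (2 * M) × TorusSite 2 L, T ℓ'.1.1 z := by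
          rw [Finset.sum_add_distrib, sum_spaceTime_eq_sum_prodTorus (T ℓ'.1.1) Y.1, sum_spaceTime_eq_sum_prodTorus_rev (T ℓ'.1.1) Y.1]
      _ = 2 * ∑ z : TorusSite 1 (2 * M) × TorusSite 2 L, T ℓ'.1.1 z := by ring
  -- sum over the labels: `ℓ' = ((ω',σ'),c')`, the bound depends on `ω'` only
  calc ∑ ℓ' : SectorLeg N, ∑ y : SpaceTimeIdx L M,
        ‖((sectorSubMatrix L M β F).transpose * normalCovariance L M p * sectorSubMatrix L M β F) Y (y, ℓ')‖
      ≤ ∑ ℓ' : SectorLeg N, 2 * ∑ z : TorusSite 1 (2 * M) × TorusSite 2 L, T ℓ'.1.1 z := Finset.sum_le_sum fun ℓ' _ => hℓ ℓ'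
    _ = ∑ ω' : Fin N, ∑ _σ' : Fin 2, ∑ _c' : Fin 2, 2 * ∑ z : TorusSite 1 (2 * M) × TorusSite 2 L, T ω' z := by
        rw [Fintype.sum_prod_type, Fintype.sum_prod_type]
    _ = 8 * ∑ ω' : Fin N, ∑ z : TorusSite 1 (2 * M) × TorusSite 2 L, T ω' z := by
        rw [Finset.mul_sum]
        refine Finset.sum_congr rfl fun ω' _ => ?_
        simp only [Finset.sum_const, Finset.card_univ, Fintype.card_fin]
        ring
    _ = _ := by rw [hT]

/-- **Column sums** of the sectorised zero-seed CT slice covariance: for every `Y' = (y, ((ω′,σ′),c′))`,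
`Σ_{Y} ‖(Sᵀ C^K_{(Λ,Λ′]} S) Y Y'‖ ≤ 8 · Σ_{ω} Σ_z ‖Σ_q χ_{q₁}(z₁)χ_{q₂}(z₂) • G_{ωω′}(q)‖` with the same symbol read at the spin `σ′` (it is
spin-independent). [cite: BenfattoGiulianiMastropietro2006, §2.7 (2.66)–(2.67)] -/
theorem colSum_norm_pullback_sliceCT_le {β : ℝ} (hβ : β ≠ 0) (μ : ℝ) (K : TrigPolyC4v) (Λ Λ' : ℝ)
    (F : Fin N → FreqMomentum L M → ℂ) (Y' : SpaceTimeIdx L M × SectorLeg N) :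
    ∑ Y : SpaceTimeIdx L M × SectorLeg N,
        ‖((sectorSubMatrix L M β F).transpose * hubbardCovSliceCT L M β μ 0 K Λ Λ' * sectorSubMatrix L M β F) Y Y'‖ ≤
      8 * ∑ ω : Fin N, ∑ z : TorusSite 1 (2 * M) × TorusSite 2 L,
        ‖∑ q : TorusSite 1 (2 * M) × TorusSite 2 L, (torusChar q.1 z.1 * torusChar q.2 z.2) •
          ((((1 / (β * (L : ℝ) ^ 2) : ℝ) : ℂ) ^ 2 *
            (F ω (⟨(q.1 0).val, ZMod.val_lt (q.1 0)⟩, q.2) * F Y'.2.1.1 (⟨(q.1 0).val, ZMod.val_lt (q.1 0)⟩, q.2) *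
              sliceSymbolFnXi (β * (L : ℝ) ^ 2) 0 Λ Λ' (matsubaraFreq β M ⟨(q.1 0).val, ZMod.val_lt (q.1 0)⟩)
                (nambuXiCT L μ K q.2))))‖ := by
  classical
  rw [hubbardCovSliceCT_eq_normalCovariance_sliceSymbolFnXi hβ μ K Λ Λ']
  set p : FreqMomentum L M × Fin 2 → ℂ := fun ks =>
    sliceSymbolFnXi (β * (L : ℝ) ^ 2) 0 Λ Λ' (matsubaraFreq β M ks.1.1) (nambuXiCT L μ K ks.1.2) with hp
  set T : Fin N → TorusSite 1 (2 * M) × TorusSite 2 L → ℝ := fun ω z =>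
    ‖∑ q : TorusSite 1 (2 * M) × TorusSite 2 L, (torusChar q.1 z.1 * torusChar q.2 z.2) •
      ((((1 / (β * (L : ℝ) ^ 2) : ℝ) : ℂ) ^ 2 *
        (F ω (⟨(q.1 0).val, ZMod.val_lt (q.1 0)⟩, q.2) * F Y'.2.1.1 (⟨(q.1 0).val, ZMod.val_lt (q.1 0)⟩, q.2) *
          p ((⟨(q.1 0).val, ZMod.val_lt (q.1 0)⟩, q.2), Y'.2.1.2))))‖ with hT
  rw [Fintype.sum_prod_type_right]
  have hℓ : ∀ ℓ : SectorLeg N, ∑ x : SpaceTimeIdx L M,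
      ‖((sectorSubMatrix L M β F).transpose * normalCovariance L M p * sectorSubMatrix L M β F) (x, ℓ) Y'‖ ≤
        2 * ∑ z : TorusSite 1 (2 * M) × TorusSite 2 L, T ℓ.1.1 z := by
    intro ℓ
    -- the symbol is spin-independent: read it at `σ'` instead of `σ`
    have hsym : ∀ (x : SpaceTimeIdx L M),
        ‖((sectorSubMatrix L M β F).transpose * normalCovariance L M p * sectorSubMatrix L M β F) (x, ℓ) Y'‖ ≤
          T ℓ.1.1 ((fun _ : Fin 1 => ((x.1 : ℕ) : ZMod (2 * M)) - ((Y'.1.1 : ℕ) : ZMod (2 * M))), x.2 - Y'.1.2) +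
            T ℓ.1.1 ((fun _ : Fin 1 => ((Y'.1.1 : ℕ) : ZMod (2 * M)) - ((x.1 : ℕ) : ZMod (2 * M))), Y'.1.2 - x.2) := by
      intro x
      have h := norm_pullback_normalCovariance_le hβ F p (x, ℓ) Y'
      have hpσ : ∀ k : FreqMomentum L M, p (k, ℓ.1.2) = p (k, Y'.2.1.2) := fun k => rfl
      simp only [hpσ] at h
      exact h
    calc ∑ x : SpaceTimeIdx L M, ‖((sectorSubMatrix L M β F).transpose * normalCovariance L M p * sectorSubMatrix L M β F) (x, ℓ) Y'‖
        ≤ ∑ x : SpaceTimeIdx L M,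
            (T ℓ.1.1 ((fun _ : Fin 1 => ((x.1 : ℕ) : ZMod (2 * M)) - ((Y'.1.1 : ℕ) : ZMod (2 * M))), x.2 - Y'.1.2) +
              T ℓ.1.1 ((fun _ : Fin 1 => ((Y'.1.1 : ℕ) : ZMod (2 * M)) - ((x.1 : ℕ) : ZMod (2 * M))), Y'.1.2 - x.2)) :=
          Finset.sum_le_sum fun x _ => hsym x
      _ = ∑ z : TorusSite 1 (2 * M) × TorusSite 2 L, T ℓ.1.1 z + ∑ z : TorusSite 1 (2 * M) × TorusSite 2 L, T ℓ.1.1 z := by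
          rw [Finset.sum_add_distrib, sum_spaceTime_eq_sum_prodTorus_rev (T ℓ.1.1) Y'.1, sum_spaceTime_eq_sum_prodTorus (T ℓ.1.1) Y'.1]
      _ = 2 * ∑ z : TorusSite 1 (2 * M) × TorusSite 2 L, T ℓ.1.1 z := by ring
  calc ∑ ℓ : SectorLeg N, ∑ x : SpaceTimeIdx L M,
        ‖((sectorSubMatrix L M β F).transpose * normalCovariance L M p * sectorSubMatrix L M β F) (x, ℓ) Y'‖
      ≤ ∑ ℓ : SectorLeg N, 2 * ∑ z : TorusSite 1 (2 * M) × TorusSite 2 L, T ℓ.1.1 z := Finset.sum_le_sum fun ℓ _ => hℓ ℓ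
    _ = ∑ ω : Fin N, ∑ _σ : Fin 2, ∑ _c : Fin 2, 2 * ∑ z : TorusSite 1 (2 * M) × TorusSite 2 L, T ω z := by
        rw [Fintype.sum_prod_type, Fintype.sum_prod_type]
    _ = 8 * ∑ ω : Fin N, ∑ z : TorusSite 1 (2 * M) × TorusSite 2 L, T ω z := by
        rw [Finset.mul_sum]
        refine Finset.sum_congr rfl fun ω _ => ?_
        simp only [Finset.sum_const, Finset.card_univ, Fintype.card_fin]
        ring
    _ = _ := by rw [hT]

end Rows

end Summit.HubbardSuperconductivity.HubbardSuperconductivity.Theorems.TorusFourierL2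

end
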